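import Summits.QuantumFields.YangMills.Theorems.BalabanUVNodesK0TopClassSmallActionMinimiser
import Summits.QuantumFields.YangMills.Theorems.BalabanUVNodesK0AveragedSingleBondFloor

/-!
# K0⁗ ROW P11 — FILE 22A: THE CORNER ENGINE FOR THE FINAL CLASS EDITIONS — one parametrised counter-instance for 12b's `VariationalThm1RegSepTop7`-SHAPED bodies
# (any numerics `ν₀`, any top domain `Sup`, thresholds `δ₀ = ρ₀·t`, `δ₁ = ρ₁·t`, two MODES for print's (7)₀): the body forces `L² < B₃·ρ₁`

Cell `pub-ymgap`, seat `pub-ymgap-dag-n21-c` g8 (R134 (a) N21 NE7c s1; K0⁗ ROW P11 negative side of record; INBOX INTENT-2 of 2026-08-27 ≈10:55Z).  Filed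
`--kind proof --supports stmt-QuantumFields-20289 --as helper`.  Part A of FILE 22 (B = `…K0VariationalThm1CoP7EmptySupport`: the corollaries).  [15] = [Balaban1985Variational];
[6] = [Balaban1985RegularSpaces]; [III] = [Balaban1988Convergent]; [I] = [Balaban1987RG1].

WHY.  Two located letters about node00-def-P11's final editions want the SAME corner witness with DIFFERENT threshold bookkeeping: (a) the floor `2L² ≤ B₃` (FILE 21: `δ₀ = 2δ₁`, the
corner plaquette pinned by (7)₀ at `t < δ₀`), now also owed for 12d's GUARDED editions `VariationalThm1RegSepTop7M` ∕ `…CoP7M` (`0 < ν.M₁`); (b) node00-def-P11's self-located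
LOCATED-P11-EMPTY-SUPPORT (INBOX l.18760): 12c `VariationalThm1RegSepCoP7` quantifies `∀ ν` INSIDE the Prop and `ν.M₁ = 0` makes def-R's support `suppDomOfRecord F ν K Ω =
hullD (F.P K) 0 1 (Ω 1) = ∅`, so (7)₀ constrains NOTHING while (8)₁ still ranges over the pinned corner plaquette — the data (7)₁ see the twist only through the (0.4) averages, at
`O(t∕L³)` (this seat's 20C `dist1_avgFun_single_star_le`), hence `¬…CoP7` far above the displayed floor.  This module proves the engine ONCE: for any `ν₀`, any `Sup`, ratios
`0 < ρ₀ ≤ 2ρ₁`, `ρ₁ ≤ 2ρ₀` (C′'s two comparability clauses), `16∕L³ < ρ₁` ((7)₁ by the impulse response, coarse plaquettes `≤ 16t∕L³`), and a MODE — `1 < ρ₀` ((7)₀ by `t < δ₀`) OR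
`Sup ν₀ 1 Ω = ∅` for all `Ω` ((7)₀ vacuous) — the Top7-shaped body AT `(ν₀, M = 1, g ≡ 1, K = k = 1)` forces `L² < B₃·ρ₁`.  Part B reads off: `ρ₁ = L²∕max(B₃,1)`, `ρ₀ = 2ρ₁` ⇒ the
floor `2L² ≤ B₃` for `…Top7M` (every `Sup`) and `…CoP7M`; `ρ₀ = ρ₁ = 32∕L³` in the empty mode ⇒ `…CoP7 → L⁵∕32 ≤ B₃` (12c unguarded; `L ≥ 13` ⇒ `B₃ ≥ 11 603`).

THE INSTANCE (theorem docstring).  On `F.P 1`: p498335's separated one-cube index (`k = 1`, `Ω₁ = Λ₁ = B(0)`, any `ν₀`), its corner plaquette `p = ⟨π(−1,−1,0,0); 0, 1⟩ ∈ plaqsOf Ω₁ =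
omegaPlaqsTop … 1`, dag-n07-e 19a's single-bond datum `U₁` twisted by `g` (`|g − 1| = t`) on the bond ENTERING `Ω₁` at `π(0)`, `W := M_𝐁(U₁)`; `t := min(u·δ_SU, a₁∕(2ρ₁), ε₀∕(2ρ₁·max(B₃,1)))`,
`u = ε₀∕(64CL³)`, `C = 2N·#Plaq + 1`, `ε₀ = min(a₀, α₀∕(2L²))`; `2N·A(U₁) < r²`, `r = ε₀∕(16L³)`, `2d·r < ε₀η₁³` ⇒ FILE 21A's minimiser `U₀` OVER THE (1.7) ∧ (1.9) TOP CLASS at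
`Sup ν₀ 1 s.Ω`; the body bounds `U₀`'s corner plaquette by `B₃ρ₁t∕L²`, the fibre pins it to `g⁻¹` of size `t` ⇒ `L² < B₃ρ₁`.
CONTENTS: ★★ `sq_L_lt_of_top7BodyAt` (theorems only; no `def`, no `sorry`, no `instance`).  HONEST FRAMING: kernel certificate engine about TREE-typed facts; nothing of Bałaban
asserted or refuted; K0⁗ neither discharged nor refuted; N21 NOT discharged; NE7c NOT PRINTED ∕ NOT PROVED; counts unmoved.
DEPENDENCES (by name): FILE 21A `K0TopClassSmallActionMinimiser.exists_isMinimizer_top_of_smallAction`; 20A–20C `K0AveragedSingleBondFloor.(dist1_avgFun_single_star_le,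
avgFun_single_eq_one_of_ne_star, exp_log_ratio_le)`; dag-n07-e 19a `(wilsonAction4_le_card_mul_sq, cornerPlaq_bonds_mem_bondsOf, plaqHol_single_corner, mixedField_avg_self)`, 17a
`dist1_plaqHol_single_le`; p498335 `(exists_seq_singleCube, cover_zero_mem_cubeEnl_zero, cover_notMem_cubeEnl_zero, lt_sitesPerDir_zero, eta_one_sq)`; p487975 `not_mem_plaqsOf_empty`; p488412
`shift_cover`; p505245 `exists_su_dist1_eq`; p510186 `plaqHol_eq_of_agreeOn_of_bonds`; node00-def-P11 12a `Sect2.(DataSmall7PTop, omegaPlaqsTop_of_ne_zero)`; `T4StabilityFloorUnitary.dist1_plaqHol_le_four_mul`.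
-/

noncomputable section

open scoped Matrix.Norms.L2Operator

namespace Summit.QuantumFields.YangMills.Theorems.K0VariationalThm1Top7Engine

open Literature.MathematicalPhysics.QuantumFieldTheory.Balaban1983to89
open Literature.MathematicalPhysics.QuantumFieldTheory.Balaban1983to89.Node00
open Literature.MathematicalPhysics.QuantumFieldTheory.Balaban1983to89.T4Continuum
open B15DeterminingSets BlockAveraging
open Literature.MathematicalPhysics.QuantumFieldTheory.Balaban1983to89.T3DescentFibreTower (holAt_one axialAvg_one avgFun_one
  expMeanLogSU_E_one loopHol_one small_one)
open ExpMeanLog (deltaSU expMeanLogSU deltaSU_pos lt_third_of_lt_deltaSU)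
open B15Eq112TorusCover
open Summit.QuantumFields.YangMills.Theorems.K0BgProvisoOverRange (shift_cover not_mem_plaqsOf_empty)
open Summit.QuantumFields.YangMills.Theorems.K0VariationalThm1ScaledCorner (cover_zero_mem_cubeEnl_zero cover_notMem_cubeEnl_zero
  exists_seq_singleCube lt_sitesPerDir_zero eta_one_sq)
open Summit.QuantumFields.YangMills.Theorems.K0VariationalThm1DatumCoupling (exists_su_dist1_eq)
open Summit.QuantumFields.YangMills.Theorems.K0VariationalThm1OuterRange (plaqHol_eq_of_agreeOn_of_bonds)
open Summit.QuantumFields.YangMills.BalabanUVNodes.N07SmallActionBoundaryAvoidance (cornerPlaq_bonds_mem_bondsOf plaqHol_single_corner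
  mixedField_avg_self wilsonAction4_le_card_mul_sq)
open Summit.QuantumFields.YangMills.BalabanUVNodes.N07Thm1ScaledInterfaceInstance (dist1_plaqHol_single_le)
open Literature.MathematicalPhysics.QuantumFieldTheory.Balaban1983to89.T4StabilityFloorUnitary (dist1_plaqHol_le_four_mul)
open Summit.QuantumFields.YangMills.Theorems.K0AveragedSingleBondFloor (dist1_avgFun_single_star_le avgFun_single_eq_one_of_ne_star exp_log_ratio_le)
open Summit.QuantumFields.YangMills.Theorems.K0TopClassSmallActionMinimiser (exists_isMinimizer_top_of_smallAction)

variable {F : T4Family} {N : ℕ} [NeZero N]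

/-- **★★ THE CORNER ENGINE.**  For ANY numerics `ν₀`, ANY top-domain selector `Sup`, ratios `0 < ρ₀ ≤ 2ρ₁`, `ρ₁ ≤ 2ρ₀`, `16∕L³ < ρ₁`, and a MODE (`1 < ρ₀`, or `Sup ν₀ 1 Ω = ∅` for every
`Ω`): if the `VariationalThm1RegSepTop7`-SHAPED body holds AT the instance `(ν₀, M = 1, g ≡ 1, K = k = 1)` (so 12b's `…Top7`, 12c's `…CoP7`, 12d's `…Top7M`∕`…CoP7M` all supply it,
the guarded ones when `0 < ν₀.M₁`), then `L² < B₃·ρ₁`.  Instance: p498335's separated one-cube index, its corner plaquette (in `omegaPlaqsTop … 1 = plaqsOf Ω₁` for every `Sup`),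
dag-n07-e 19a's single-bond datum twisted by `g`, `|g − 1| = t` tiny, on the bond entering `Ω₁` at its corner, `W := M_𝐁(U₁)`, thresholds `δ₀ = ρ₀t`, `δ₁ = ρ₁t` (comparable both
ways; `0 < δ_n ≤ a₁`, `B₃δ_n ≤ ε₀` by the choice of `t`); (7)₀ by the mode (`|U₁(∂q) − 1| ≤ t < ρ₀t`, or an empty range), (7)₁ by the impulse response of the (0.4) averaging (20C:
coarse plaquettes `≤ 16t∕L³ < ρ₁t`); FILE 21A's minimiser over the (1.7) ∧ (1.9) Top class (`2N·A(U₁) < r²`, `r = ε₀∕(16L³)`, `2d·r < ε₀η₁³`); the body's (8)₁ at the pinned corner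
plaquette `g⁻¹` reads `t < B₃·ρ₁t·L⁻²`.
[cite: Balaban1985Variational, (2),(6) p.278, Thm 1 (7)–(8) pp.278–279; Balaban1985RegularSpaces, (1.3)–(1.10) p.77; Balaban1987RG1, (0.4) p.253; Balaban1988Convergent, (2.2) p.255, (2.10)–(2.13) pp.256–257 (bookkeeping)] -/
theorem sq_L_lt_of_top7BodyAt (Sup : (ν : Stage7Numerics) → (K : ℕ) → (ℕ → Set (Site (F.P K) 0)) → Set (Site (F.P K) 0))
    (ν₀ : Stage7Numerics) (hN : 2 ≤ N) {B₃ a₀ a₁ : ℝ} (ha₀ : 0 < a₀) (ha₁ : 0 < a₁)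
    {ρ₀ ρ₁ : ℝ} (hρ₀ : 0 < ρ₀) (hρ₁ : 16 / (F.L : ℝ) ^ 3 < ρ₁) (hc : ρ₀ ≤ 2 * ρ₁) (hc' : ρ₁ ≤ 2 * ρ₀)
    (hmode : 1 < ρ₀ ∨ ∀ Ω, Sup ν₀ 1 Ω = ∅)
    (h : ∀ s : SeqOfRecord F ν₀ 1 (fun _ => (1 : ℝ)) 1 1, Sect2.SeqSeparated ν₀.M₁ s → ∀ (ε₀ : ℝ) (δ : ℕ → ℝ),
      (∀ n, n ≤ 1 → 0 < δ n ∧ δ n ≤ a₁ ∧ B₃ * δ n ≤ ε₀) → (∀ n, n < 1 → δ n ≤ 2 * δ (n + 1)) → (∀ n, n < 1 → δ (n + 1) ≤ 2 * δ n) → ε₀ ≤ a₀ →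
      ∀ W : MSField (F.P 1) (SU N), Sect2.DataSmall7PTop (avOfRecord F N 1) s.Ω (Sup ν₀ 1 s.Ω) 1 δ W →
        ∀ U₀, IsMinimizer (avOfRecord F N 1)
            {U | (∀ n, n ≤ 1 → PlaqSmallOn (Sect2.omegaPlaqsTop s.Ω (Sup ν₀ 1 s.Ω) n) (ε₀ * (F.P 1).eta n ^ 2) U) ∧
              Sect2.CoDivClassOnTop s.Ω (Sup ν₀ 1 s.Ω) 1 ε₀ U} (genSet s.Ω 1) W U₀ →
          (∀ n, n ≤ 1 → PlaqSmallOn (Sect2.omegaPlaqsTop s.Ω (Sup ν₀ 1 s.Ω) n) (B₃ * δ n * (F.P 1).eta n ^ 2) U₀) ∧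
            ∀ n, n ≤ 1 → Sect2.CoDivSmallOn (Sect2.omegaBondsTop s.Ω (Sup ν₀ 1 s.Ω) n) (B₃ * δ n * (F.P 1).eta n ^ 3) U₀) :
    (F.L : ℝ) ^ 2 < B₃ * ρ₁ := by
  classical
  by_contra hB
  rw [not_lt] at hB
  -- the torus `F.P 1`
  set P : Params := F.P 1 with hPdef
  have hPL : P.L = F.L := T4Family.P_L F 1
  have hPd : P.d = 4 := T4Family.P_d F 1
  have hL11 : 11 < F.L := F.hL11
  have hLR : (12 : ℝ) ≤ F.L := by exact_mod_cast (show 12 ≤ F.L by omega)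
  have hL1 : (1 : ℝ) ≤ F.L := by linarith only [hLR]
  have hLpos : (0 : ℝ) < F.L := by linarith only [hLR]
  obtain ⟨hL2pos, hL3pos⟩ : (0 : ℝ) < (F.L : ℝ) ^ 2 ∧ (0 : ℝ) < (F.L : ℝ) ^ 3 := ⟨by positivity, by positivity⟩
  have hL2ge : (1 : ℝ) ≤ (F.L : ℝ) ^ 2 := one_le_pow₀ hL1
  have hL3ge : (32 : ℝ) ≤ (F.L : ℝ) ^ 3 := by
    have h12 : (12 : ℝ) ^ 3 ≤ (F.L : ℝ) ^ 3 := pow_le_pow_left₀ (by norm_num) hLR 3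
    norm_num at h12
    linarith only [h12]
  have hsites : P.sitesPerDir 0 = 2 * F.L ^ (F.m + 1) := T4Family.sitesPerDir_eq F 1
  have hper2 : 2 * P.L < P.sitesPerDir 0 := by
    rw [hsites, hPL]
    have : F.L < F.L ^ (F.m + 1) := by
      calc F.L = F.L ^ 1 := (pow_one _).symm
        _ < F.L ^ (F.m + 1) := Nat.pow_lt_pow_right (by omega) (by have := F.hm; omega)
    omega
  have hperL : F.L < P.sitesPerDir 0 := lt_sitesPerDir_zero F 1
  have hL3 : 3 ≤ P.L := by rw [hPL]; omega
  have hj : 0 + 1 ≤ P.m + P.K := by show 0 + 1 ≤ F.m + 1; omega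
  -- directions `μ₀ = 0 < ν₁ = 1`
  set μ0 : Fin P.d := ⟨0, by rw [hPd]; norm_num⟩ with hμ0
  set ν₁ : Fin P.d := ⟨1, by rw [hPd]; norm_num⟩ with hν₁
  have hne : ν₁ ≠ μ0 := by intro h'; have := congrArg Fin.val h'; simp [hμ0, hν₁] at this
  have hμν : μ0 < ν₁ := Fin.mk_lt_mk.2 (by norm_num)
  -- the corner plaquette `p = ⟨π(−1,−1,0,0); 0, 1⟩`, the twisted bond `⟨x′, 0⟩`, `x′ = π(−1,0,0,0)`, the neighbouring block `y₁ = −e₀`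
  set w₀ : Fin P.d → ℤ := fun i => if i = μ0 ∨ i = ν₁ then -1 else 0 with hw₀
  have hw₀μ : w₀ μ0 = -1 := by simp [hw₀]
  have hw₀ν : w₀ ν₁ = -1 := by simp [hw₀]
  set p : Plaq P 0 := ⟨cover P w₀, μ0, ν₁, hμν⟩ with hp
  set x' : Site P 0 := p.src.shift p.ν with hx'
  set y₁ : Site P 1 := (0 : Site P 1).unshift μ0 with hy₁
  set hh : ℕ := (P.L - 1) / 2 with hhh
  have hL2 : 2 * hh + 1 = P.L := AveragingRT.two_mul_half_add_one P
  -- coordinates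
  have hx'κ : ∀ κ, x' κ = if κ = ν₁ then 0 else ((w₀ κ : ℤ) : ZMod (P.sitesPerDir 0)) := by
    intro κ
    show ((cover P w₀).shift ν₁) κ = _
    rw [Site.shift_apply, cover_apply, cover_apply]
    by_cases hκ : κ = ν₁
    · rw [if_pos hκ, if_pos hκ, hw₀ν]; push_cast; ring
    · rw [if_neg hκ, if_neg hκ]
  have hemb0 : ∀ κ, emb (0 : Site P 1) κ = ((hh : ℕ) : ZMod (P.sitesPerDir 0)) := by
    intro κ
    show (((((0 : Site P 1) κ).val * P.L + (P.L - 1) / 2 : ℕ)) : ZMod (P.sitesPerDir 0)) = _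
    rw [Site.zero_apply, ZMod.val_zero, zero_mul, zero_add]
  have hemby : ∀ κ, emb y₁ κ = ((hh : ℕ) : ZMod (P.sitesPerDir 0)) - (if κ = μ0 then (P.L : ZMod (P.sitesPerDir 0)) else 0) := by
    intro κ
    have h1 := emb_shift_apply y₁ μ0 κ
    rw [show y₁.shift μ0 = 0 from Site.shift_unshift 0 μ0, hemb0] at h1
    rw [h1]; ring
  have hx0 : x' μ0 = emb y₁ μ0 + ((hh : ℕ) : ZMod (P.sitesPerDir 0)) := by
    rw [hx'κ, if_neg (Ne.symm hne), hw₀μ, hemby, if_pos rfl]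
    have hc : ((P.L : ℕ) : ZMod (P.sitesPerDir 0)) = 2 * ((hh : ℕ) : ZMod (P.sitesPerDir 0)) + 1 := by
      rw [← hL2]; push_cast; ring
    rw [hc]; push_cast; ring
  have hxκ : ∀ κ, κ ≠ μ0 → x' κ + ((hh : ℕ) : ZMod (P.sitesPerDir 0)) = emb y₁ κ := by
    intro κ hκ
    rw [hx'κ, hemby, if_neg hκ, sub_zero]
    by_cases hκ' : κ = ν₁
    · rw [if_pos hκ', zero_add]
    · rw [if_neg hκ']
      have : w₀ κ = 0 := by simp [hw₀, hκ, hκ']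
      rw [this]; push_cast; ring
  -- the index `k = 1`, `Ω₁ = B(0)`
  obtain ⟨s, hsΩ, hsep⟩ := exists_seq_singleCube F ν₀ 1
  have hsΩ' : s.Ω 1 = cubeEnl P P.L 0 0 := by rw [hsΩ, hPL]
  -- the three near corners are off `Ω₁`, the far corner `π(0)` is in it
  have h1 : p.src ∉ s.Ω 1 := by rw [hsΩ']; exact cover_notMem_cubeEnl_zero (by rw [hPL]; exact hperL) w₀ hw₀μ
  have h2 : p.src.shift p.μ ∉ s.Ω 1 := by
    rw [hsΩ']; show (cover P w₀).shift μ0 ∉ _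
    rw [shift_cover]
    exact cover_notMem_cubeEnl_zero (by rw [hPL]; exact hperL) _ (i := ν₁) (by rw [Function.update_of_ne hne, hw₀ν])
  have h3 : p.src.shift p.ν ∉ s.Ω 1 := by
    rw [hsΩ']; show (cover P w₀).shift ν₁ ∉ _
    rw [shift_cover]
    exact cover_notMem_cubeEnl_zero (by rw [hPL]; exact hperL) _ (i := μ0) (by rw [Function.update_of_ne (Ne.symm hne), hw₀μ])
  have hfar : (p.src.shift p.μ).shift p.ν ∈ s.Ω 1 := by
    rw [hsΩ']; show ((cover P w₀).shift μ0).shift ν₁ ∈ _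
    rw [shift_cover, shift_cover]
    have h0 : Function.update (Function.update w₀ μ0 (w₀ μ0 + 1)) ν₁ (Function.update w₀ μ0 (w₀ μ0 + 1) ν₁ + 1) = 0 := by
      funext i
      by_cases hiν : i = ν₁
      · subst hiν; rw [Function.update_self, Function.update_of_ne hne, hw₀ν]; norm_num
      · rw [Function.update_of_ne hiν]
        by_cases hiμ : i = μ0
        · subst hiμ; rw [Function.update_self, hw₀μ]; norm_num
        · rw [Function.update_of_ne hiμ]; simp [hw₀, hiμ, hiν]
    rw [h0]
    exact cover_zero_mem_cubeEnl_zero (by omega)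
  have hpX : p ∈ B8Eq17ClassAkV1.plaqsOf (s.Ω 1) := Or.inr (Or.inr (Or.inr hfar))
  -- the parameters (plain variables with defining equations — no `let`s, to keep `whnf` away from real-number definitions)
  obtain ⟨β, hβ⟩ : ∃ β : ℝ, β = max B₃ 1 := ⟨_, rfl⟩
  have hβ1 : 1 ≤ β := by rw [hβ]; exact le_max_right _ _
  have hβpos : 0 < β := by linarith only [hβ1]
  have hβB : B₃ ≤ β := by rw [hβ]; exact le_max_left _ _
  obtain ⟨δS, hδS, hδSpos, hδS3⟩ : ∃ δS : ℝ, δS = deltaSU (Fin N) ∧ 0 < δS ∧ δS ≤ 1 / 3 :=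
    ⟨_, rfl, deltaSU_pos, min_le_left _ _⟩
  obtain ⟨α₀, hα₀⟩ : ∃ α₀ : ℝ, α₀ = min (1 / 109824) (δS / (64 * (F.L : ℝ) ^ 2)) := ⟨_, rfl⟩
  have hα₀pos : 0 < α₀ := by rw [hα₀]; exact lt_min (by norm_num) (by positivity)
  have hα₀1 : α₀ ≤ 1 / 109824 := by rw [hα₀]; exact min_le_left _ _
  have hα₀2 : α₀ ≤ δS / (64 * (F.L : ℝ) ^ 2) := by rw [hα₀]; exact min_le_right _ _
  obtain ⟨ε₀, hε₀⟩ : ∃ ε₀ : ℝ, ε₀ = min a₀ (α₀ / (2 * (F.L : ℝ) ^ 2)) := ⟨_, rfl⟩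
  have hε₀pos : 0 < ε₀ := by rw [hε₀]; exact lt_min ha₀ (by positivity)
  have hε₀a₀ : ε₀ ≤ a₀ := by rw [hε₀]; exact min_le_left _ _
  have hε₀2 : ε₀ ≤ α₀ / (2 * (F.L : ℝ) ^ 2) := by rw [hε₀]; exact min_le_right _ _
  have hε₀α : ε₀ < α₀ * P.eta 1 ^ 2 := by
    rw [show P.eta 1 ^ 2 = ((F.L : ℝ) ^ 2)⁻¹ from eta_one_sq (F := F) 1]
    calc ε₀ ≤ α₀ / (2 * (F.L : ℝ) ^ 2) := hε₀2
      _ < α₀ * ((F.L : ℝ) ^ 2)⁻¹ := by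
          rw [div_eq_mul_inv, mul_inv, ← mul_assoc]
          have : α₀ * 2⁻¹ < α₀ := by linarith only [hα₀pos]
          exact mul_lt_mul_of_pos_right this (by positivity)
  have hε₀small : ε₀ ≤ 1 := by
    have h2 : α₀ / (2 * (F.L : ℝ) ^ 2) ≤ α₀ := div_le_self hα₀pos.le (by linarith only [hL2ge])
    linarith only [hε₀2, h2, hα₀1]
  obtain ⟨C, hC⟩ : ∃ C : ℝ, C = 2 * N * (Fintype.card (Plaq P 0) : ℝ) + 1 := ⟨_, rfl⟩
  have hC0 : (0 : ℝ) ≤ 2 * N * (Fintype.card (Plaq P 0) : ℝ) := by positivity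
  have hC1 : 1 ≤ C := by linarith only [hC, hC0]
  have hCpos : 0 < C := by linarith only [hC1]
  -- the twist size `t` (tiny) and the thresholds `δ₀ = ρ₀·t`, `δ₁ = ρ₁·t`
  have hρ₁pos : 0 < ρ₁ := lt_trans (by positivity) hρ₁
  have hL3eq : (F.L : ℝ) * (F.L : ℝ) ^ 2 = (F.L : ℝ) ^ 3 := by ring
  obtain ⟨u, hu⟩ : ∃ u : ℝ, u = ε₀ / (64 * C * (F.L : ℝ) ^ 3) := ⟨_, rfl⟩
  have hupos : 0 < u := by rw [hu]; positivity
  obtain ⟨t, ht⟩ : ∃ t : ℝ, t = min (u * δS) (min (a₁ / (2 * ρ₁)) (ε₀ / (2 * ρ₁ * β))) := ⟨_, rfl⟩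
  have htpos : 0 < t := by rw [ht]; exact lt_min (by positivity) (lt_min (by positivity) (by positivity))
  have htu : t ≤ u * δS := by rw [ht]; exact min_le_left _ _
  have hta : t ≤ a₁ / (2 * ρ₁) := by rw [ht]; exact (min_le_right _ _).trans (min_le_left _ _)
  have htb : t ≤ ε₀ / (2 * ρ₁ * β) := by rw [ht]; exact (min_le_right _ _).trans (min_le_right _ _)
  have htu3 : t ≤ u / 3 := htu.trans (by nlinarith only [hδS3, hupos])
  have hCL3 : (1 : ℝ) ≤ C * (F.L : ℝ) ^ 3 := one_le_mul_of_one_le_of_one_le hC1 (by linarith only [hL3ge])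
  have huε : u ≤ ε₀ / 64 := by
    rw [hu, show (64 : ℝ) * C * (F.L : ℝ) ^ 3 = 64 * (C * (F.L : ℝ) ^ 3) by ring, ← div_div]
    exact div_le_self (by positivity) hCL3
  have htε : t < ε₀ / (F.L : ℝ) ^ 2 := by
    have h2 : u ≤ ε₀ / (F.L : ℝ) ^ 2 := by
      rw [hu]; exact div_le_div_of_nonneg_left hε₀pos.le hL2pos (by nlinarith only [hC1, hL1, hL2pos, hL3pos, hL3eq])
    exact (htu3.trans_lt (by linarith only [hupos])).trans_le h2
  have htδS : t < δS := by
    refine htu.trans_lt ?_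
    calc u * δS ≤ ε₀ / 64 * δS := mul_le_mul_of_nonneg_right huε hδSpos.le
      _ < 1 * δS := mul_lt_mul_of_pos_right (by linarith only [hε₀small]) hδSpos
      _ = δS := one_mul _
  have ht12 : t ≤ 1 / 2 := by linarith only [htδS, hδS3]
  obtain ⟨ht1', ht2⟩ : t < 1 ∧ t ≤ 2 := ⟨by linarith only [ht12], by linarith only [ht12]⟩
  obtain ⟨δ₁, hδ₁⟩ : ∃ δ₁ : ℝ, δ₁ = ρ₁ * t := ⟨_, rfl⟩
  have hδ₁pos : 0 < δ₁ := by rw [hδ₁]; positivity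
  have h2δ₁a : 2 * δ₁ ≤ a₁ := by
    rw [hδ₁]
    have h1 := mul_le_mul_of_nonneg_left hta (by positivity : (0 : ℝ) ≤ 2 * ρ₁)
    calc 2 * (ρ₁ * t) = 2 * ρ₁ * t := by ring
      _ ≤ 2 * ρ₁ * (a₁ / (2 * ρ₁)) := h1
      _ = a₁ := by field_simp
  have h2δ₁ε : β * (2 * δ₁) ≤ ε₀ := by
    rw [hδ₁]
    have h1 := mul_le_mul_of_nonneg_left htb (by positivity : (0 : ℝ) ≤ 2 * ρ₁ * β)
    calc β * (2 * (ρ₁ * t)) = 2 * ρ₁ * β * t := by ring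
      _ ≤ 2 * ρ₁ * β * (ε₀ / (2 * ρ₁ * β)) := h1
      _ = ε₀ := by field_simp
  -- the twist
  obtain ⟨g, hg⟩ := exists_su_dist1_eq (N := N) hN htpos.le ht2
  set U₁ : GaugeField P 0 (Matrix.specialUnitaryGroup (Fin N) ℂ) := fun b => if b.src = x' ∧ b.dir = μ0 then g else 1 with hU₁
  set W : MSField P (Matrix.specialUnitaryGroup (Fin N) ℂ) := avgFamily (avOfRecord F N 1) U₁ with hW
  -- fine plaquettes of `U₁`
  have hμ0min : ∀ ν : Fin P.d, ¬ ν < μ0 := fun ν hν => Nat.not_lt_zero ν.val (Fin.lt_def.mp hν)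
  have hU₁q : ∀ q : Plaq P 0, dist1 (GaugeField.plaqHol U₁ q) ≤ t := fun q => (dist1_plaqHol_single_le x' hμ0min g q).trans_eq hg
  -- coarse bonds of `Ū₁`
  obtain ⟨τ, hτ⟩ : ∃ τ : ℝ, τ = Real.exp (1 / (F.L : ℝ) ^ 3 * (-Real.log (1 - t))) - 1 := ⟨_, rfl⟩
  have hτle : τ ≤ 4 * t / (F.L : ℝ) ^ 3 := by rw [hτ]; exact exp_log_ratio_le htpos.le ht12 hL1
  have hτ0 : 0 ≤ τ := by
    rw [hτ, sub_nonneg]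
    refine Real.one_le_exp ?_
    have : 0 ≤ -Real.log (1 - t) := by
      rw [neg_nonneg]; exact Real.log_nonpos (by linarith only [ht1']) (by linarith only [htpos])
    positivity
  have hcoarse : ∀ b : PBond P 1, dist1 (avgFun expMeanLogSU U₁ b) ≤ τ := by
    intro b
    by_cases hb : b = ⟨y₁, μ0⟩
    · rw [hb, hτ]
      have hmain := dist1_avgFun_single_star_le (N := N) hper2 hL3 hne y₁ x' g hx0 hxκ hg.le (hδS ▸ htδS) ht1'
      have h3 : (P.L : ℝ) ^ (P.d - 1) = (F.L : ℝ) ^ 3 := by rw [hPL, hPd]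
      rw [h3] at hmain
      exact hmain
    · rw [avgFun_single_eq_one_of_ne_star expMeanLogSU expMeanLogSU_E_one hj hper2 y₁ x' g hx0 hxκ b hb, GaugeGroup.dist1_one]
      exact hτ0
  have h16t : 16 * t < δ₁ * (F.L : ℝ) ^ 3 := by
    rw [hδ₁]
    have h1 := mul_lt_mul_of_pos_right hρ₁ htpos
    rw [div_mul_eq_mul_div, div_lt_iff₀ hL3pos] at h1
    linarith only [h1]
  have hcoarseq : ∀ q : Plaq P 1, dist1 (GaugeField.plaqHol (avgFun expMeanLogSU U₁) q) < δ₁ := by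
    intro q
    refine (dist1_plaqHol_le_four_mul hcoarse q).trans_lt ?_
    calc 4 * τ ≤ 4 * (4 * t / (F.L : ℝ) ^ 3) := by linarith only [hτle]
      _ = 16 * t / (F.L : ℝ) ^ 3 := by ring
      _ < δ₁ := by rw [div_lt_iff₀ hL3pos]; exact h16t
  -- the thresholds
  set δ : ℕ → ℝ := fun n => if n = 0 then ρ₀ * t else δ₁ with hδdef
  have hδ0 : δ 0 = ρ₀ * t := if_pos rfl
  have hδ1 : δ 1 = δ₁ := if_neg one_ne_zero
  have hδ0le : ρ₀ * t ≤ 2 * δ₁ := by rw [hδ₁]; nlinarith only [hc, htpos]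
  have hδ0pos : 0 < ρ₀ * t := by positivity
  have hδ : ∀ n, n ≤ 1 → 0 < δ n ∧ δ n ≤ a₁ ∧ B₃ * δ n ≤ ε₀ := by
    have hBε : ∀ x : ℝ, 0 < x → x ≤ 2 * δ₁ → B₃ * x ≤ ε₀ := by
      intro x hx hx2
      rcases le_or_gt B₃ 0 with hB0 | hB0
      · exact (mul_nonpos_iff.mpr (Or.inr ⟨hB0, hx.le⟩)).trans hε₀pos.le
      · calc B₃ * x ≤ β * x := mul_le_mul_of_nonneg_right hβB hx.le
          _ ≤ β * (2 * δ₁) := mul_le_mul_of_nonneg_left hx2 hβpos.le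
          _ ≤ ε₀ := h2δ₁ε
    intro n hn
    rcases Nat.le_one_iff_eq_zero_or_eq_one.mp hn with rfl | rfl
    · rw [hδ0]; exact ⟨hδ0pos, hδ0le.trans h2δ₁a, hBε _ hδ0pos hδ0le⟩
    · rw [hδ1]; exact ⟨hδ₁pos, by linarith only [h2δ₁a, hδ₁pos], hBε _ hδ₁pos (by linarith only [hδ₁pos])⟩
  have hcomp : ∀ n, n < 1 → δ n ≤ 2 * δ (n + 1) := by
    intro n hn
    have hn0 : n = 0 := by omega
    subst hn0
    rw [hδ0, hδ1]; exact hδ0le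
  have hcomp' : ∀ n, n < 1 → δ (n + 1) ≤ 2 * δ n := by
    intro n hn
    have hn0 : n = 0 := by omega
    subst hn0
    rw [hδ0, hδ1, hδ₁]; nlinarith only [hc', htpos]
  -- (7) on the top-domain range for `W = M_𝐁(U₁)`: level 0 by the MODE (`t < δ₀`, or an empty support), level 1 by the impulse response
  have h7top : Sect2.DataSmall7PTop (avOfRecord F N 1) s.Ω (Sup ν₀ 1 s.Ω) 1 δ W := by
    refine ⟨fun q hq => ?_, fun m hm q _ => ?_⟩
    · rw [hδ0]
      rcases hmode with hρ | hS
      · exact (hU₁q q).trans_lt (by nlinarith only [hρ, htpos])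
      · rw [hS] at hq
        exact (not_mem_plaqsOf_empty q hq.2).elim
    · have hm0 : m = 0 := by omega
      subst hm0
      rw [hδ1]
      show dist1 (GaugeField.plaqHol (Sect2.mixedField (avOfRecord F N 1) (genSet s.Ω 1 (0 + 1))
        ((avOfRecord F N 1 0).avg U₁) U₁) q) < δ₁
      rw [mixedField_avg_self, avOfRecord_avg]
      exact hcoarseq q
  -- `U₁` lies in the `ε₀`-class with small action
  have hU₁cls : ∀ n, n ≤ 1 → PlaqSmallOn (omegaPlaqs s.Ω n) (ε₀ * P.eta n ^ 2) U₁ := by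
    intro n hn q _
    refine (hU₁q q).trans_lt (htε.trans_le ?_)
    rcases Nat.le_one_iff_eq_zero_or_eq_one.mp hn with rfl | rfl
    · simp only [Params.eta, pow_zero, one_pow, mul_one]
      exact div_le_self hε₀pos.le hL2ge
    · rw [show P.eta 1 ^ 2 = ((F.L : ℝ) ^ 2)⁻¹ from eta_one_sq (F := F) 1, div_eq_mul_inv]
  have hA : AgreeOn (genSet s.Ω 1) (avgFamily (avOfRecord F N 1) U₁) W := fun _ _ _ => rfl
  -- the radius `r = ε₀/(16L³)` of boundary avoidance through (1.9): `C·t ≤ r`, so `2N·A(U₁) < r²` and `2d·r < ε₀η₁³`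
  obtain ⟨r, hr⟩ : ∃ r : ℝ, r = ε₀ / (16 * (F.L : ℝ) ^ 3) := ⟨_, rfl⟩
  have hr0 : 0 ≤ r := by rw [hr]; positivity
  have hCt : C * t ≤ r := by
    calc C * t ≤ C * (u / 3) := mul_le_mul_of_nonneg_left htu3 hCpos.le
      _ = ε₀ / (192 * (F.L : ℝ) ^ 3) := by rw [hu]; field_simp; ring
      _ ≤ r := by rw [hr]; exact div_le_div_of_nonneg_left hε₀pos.le (by positivity) (by nlinarith only [hL3pos])
  have htr : t ≤ r := (le_mul_of_one_le_left htpos.le hC1).trans hCt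
  have hact : 2 * N * wilsonAction4 U₁ < r ^ 2 := by
    have hAle := wilsonAction4_le_card_mul_sq hU₁q
    have hN0 : (0 : ℝ) ≤ 2 * N := by positivity
    calc 2 * N * wilsonAction4 U₁ ≤ 2 * N * ((Fintype.card (Plaq P 0) : ℝ) * t ^ 2) := mul_le_mul_of_nonneg_left hAle hN0
      _ = (C - 1) * t ^ 2 := by rw [hC]; ring
      _ < C * t ^ 2 := by
          have h' : (C - 1) * t ^ 2 = C * t ^ 2 - t ^ 2 := by ring
          rw [h']; linarith only [pow_pos htpos 2]
      _ = (C * t) * t := by ring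
      _ ≤ r * r := mul_le_mul hCt htr htpos.le hr0
      _ = r ^ 2 := (sq r).symm
  have hη1 : P.eta 1 = ((F.L : ℝ))⁻¹ := by simp [Params.eta, hPL]
  have hη3 : P.eta 1 ^ 3 = ((F.L : ℝ) ^ 3)⁻¹ := by rw [hη1, inv_pow]
  have hrη : (P.d : ℝ) * (2 * r) < ε₀ * P.eta 1 ^ 3 := by
    rw [hPd, hη3, hr]
    push_cast
    have hpos : 0 < ε₀ * ((F.L : ℝ) ^ 3)⁻¹ := by positivity
    have heq : (4 : ℝ) * (2 * (ε₀ / (16 * (F.L : ℝ) ^ 3))) = ε₀ * ((F.L : ℝ) ^ 3)⁻¹ / 2 := by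
      field_simp; ring
    rw [heq]
    linarith only [hpos]
  have hα3 : (143 * ((((P.d + 4 : ℕ) : ℝ)) ^ 2 / 4) ^ 2) * α₀ ≤ 1 / 3 := by
    rw [hPd]; norm_num
    linarith only [hα₀1]
  have hα2 : 2 * α₀ ≤ 2 * deltaSU (Fin N) / (((P.d + 4) * P.L : ℕ) : ℝ) ^ 2 := by
    have h64 : (((P.d + 4) * P.L : ℕ) : ℝ) ^ 2 = 64 * (F.L : ℝ) ^ 2 := by
      rw [hPd, hPL]; push_cast; ring
    rw [h64, mul_div_assoc, ← hδS]
    linarith only [hα₀2]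
  obtain ⟨U₀, hmin, -⟩ := exists_isMinimizer_top_of_smallAction F 1 one_pos s.Ω (Sup ν₀ 1 s.Ω) hα₀pos hα3 hα2
    hε₀pos.le hε₀α hr0 hrη hU₁cls hA hact
  -- the fact bounds the corner plaquette of `U₀` …
  have hp1 : p ∈ Sect2.omegaPlaqsTop s.Ω (Sup ν₀ 1 s.Ω) 1 := by
    rw [Sect2.omegaPlaqsTop_of_ne_zero _ _ one_ne_zero, omegaPlaqs_of_ne_zero s.Ω one_ne_zero]; exact hpX
  have hbound := (h s hsep ε₀ δ hδ hcomp hcomp' hε₀a₀ W h7top U₀ hmin).1 1 le_rfl p hp1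
  -- … which is pinned to `U₁`'s value `g⁻¹`
  obtain ⟨hb1, hb2, hb3, hb4⟩ := cornerPlaq_bonds_mem_bondsOf one_pos s.Ω p h1 h2 h3
  have hpin : GaugeField.plaqHol U₀ p = g⁻¹ := by
    rw [plaqHol_eq_of_agreeOn_of_bonds (avOfRecord F N 1) hmin.2.1 p hb1 hb2 hb3 hb4]
    exact plaqHol_single_corner p g
  rw [hpin, GaugeGroup.dist1_inv, hg, hδ1, hδ₁, show P.eta 1 ^ 2 = ((F.L : ℝ) ^ 2)⁻¹ from eta_one_sq (F := F) 1,
    ← div_eq_mul_inv, lt_div_iff₀ hL2pos] at hbound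
  have hle : B₃ * (ρ₁ * t) ≤ t * (F.L : ℝ) ^ 2 := by nlinarith only [hB, htpos]
  exact absurd hbound (not_lt.mpr hle)

end Summit.QuantumFields.YangMills.Theorems.K0VariationalThm1Top7Engine

end
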